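import Mathlib.Analysis.SpecialFunctions.Complex.Log
import Mathlib.FieldTheory.IntermediateField.Adjoin.Defs
import Mathlib.RingTheory.AlgebraicIndependent.Basic
import Mathlib.LinearAlgebra.Dimension.Finite
import Mathlib.LinearAlgebra.FiniteDimensional.Basic
import Mathlib.LinearAlgebra.Dimension.Constructions
import Mathlib.FieldTheory.IntermediateField.Adjoin.Basic
import Mathlib.RingTheory.AlgebraicIndependent.TranscendenceBasis
import Mathlib.RingTheory.AlgebraicIndependent.AlgebraicClosure
import HarnessLib
import HarnessLib.Audit

/-!
# Toric 1-motives `[ℤʳ → 𝔾ₘⁿ]`, their periods, and André's generalised period conjecture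

Topic `Literature/NumberTheory/Transcendental` (definition item `defn-OneMotiveToric`, route
`Schanuel/ToricPeriods`).

A *1-motive* over a subfield `k ⊆ ℂ` is `M = [u : X → G]` with `X` a finitely generated free
`ℤ`-module, `G` a semi-abelian variety over `k` and `u : X → G(k)` a homomorphism (Deligne,
*Hodge III*, §10). We formalise the **toric** case `X = ℤʳ`, `G = 𝔾ₘⁿ` (no abelian part), which
is exactly the case in which André's generalised period conjecture (GPC) becomes Schanuel's
conjecture (André 2004, §23.4; Bertolin 2002, Cor. 1.3 and §3; André's letter in
Bertolin 2020: "the case of 1-motives without abelian part, in which case one recovers Schanuel's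
conjecture").

* `OneMotiveToric k r n` — the datum of `M = [u : ℤʳ → 𝔾ₘⁿ]` over `k : IntermediateField ℚ ℂ`:
  the images `u(eᵢ) = (u i 1, …, u i n) ∈ 𝔾ₘⁿ(k) = (kˣ)ⁿ`, i.e. a matrix `u : Fin r → Fin n → ℂ`
  of non-zero elements of `k`.
* `M.logSet = {ℓ | exp ℓ = u i j}` (all determinations of all `log u i j`) and
  `M.periodSet = {2πi | n ≠ 0} ∪ M.logSet` — the entries of Deligne's period matrix of `M`
  other than `0, 1`: the period isomorphism `T_dR(M) ⊗ ℂ ≅ T_B(M) ⊗ ℂ` of `[ℤʳ → 𝔾ₘⁿ]` is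
  block-triangular with entries `1` (from `ℤʳ`), `2πi` (from each `𝔾ₘ`) and one determination of
  `log u i j` (Bertolin 2002, §3; Huber–Wüstholz 2022, Part II). Taking *all* determinations makes
  the definition branch-free; it changes neither the field generated over `k` nor the `ℚ`-span,
  since determinations differ by `2πi ℤ` and `2πi` is a period whenever `n ≠ 0`.
* `M.periodFieldOver = k(periods(M)) : IntermediateField k ℂ` and its restriction of scalars
  `M.periodField : IntermediateField ℚ ℂ` (same subfield of `ℂ`).
* `M.motGaloisDim = dim_ℚ span_ℚ (periodSet M) : ℕ` — the dimension of the motivic Galois group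
  `Gal_mot(M)` (theorem-as-definition): `Gal_mot([ℤʳ → 𝔾ₘⁿ])` is an extension of `𝔾ₘ`
  (weight `-2` part `ℚ(1)ⁿ`, present iff `n ≠ 0`) by its unipotent radical, whose dimension is
  the rank of the subgroup of `kˣ/torsion` generated by the `u i j` (Bertolin 2002, §3;
  Bertolin 2020, §3), and `1 + rk = dim_ℚ ⟨2πi, log u i j⟩_ℚ` by the exact sequence
  `0 → 2πiℚ → ⟨2πi, log u⟩_ℚ → ⟨u⟩ ⊗ ℚ → 0` (kernel of `exp` on a `ℚ`-span containing `2πi`).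
  For `n = 0` (`M = ℤʳ`, an Artin motive) it is `0`.
* `M.GPC` — André's generalised period conjecture for `M`:
  `trdeg_ℚ k(periods(M)) ≥ dim Gal_mot(M)` (André 2004, §23.4.1; Bertolin 2020, Conj. 0.1),
  and `ToricPeriodConjecture := ∀ k r n M, M.GPC`. Both are registered **OPEN STATEMENTS**, not
  named-fact debt (verdict clean-up 2026-08-15, re-verified on the page): the inequality is
  printed as a CONJECTURE wherever it appears — André's `(?!)` "(Generalized) period conjecture
  over an arbitrary subfield of `ℂ`", first published as [IM] = André 2004, §23.4 (André's letter
  in Bertolin 2020, appendix); Bertolin 2002, p. 205 "Conjecture des périodes généralisée pour les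
  1-motifs (André)" `(CPG)_K`; Bertolin 2020, Introduction, Conj. 0.1 "Generalized Grothendieck's
  Period Conjecture for 1-motives" — and for the toric 1-motives it is *equivalent to Schanuel's
  conjecture* (Bertolin 2002, Cor. 1.3, proved in tree as
  `toricPeriodConjecture_iff_schanuel_holds`; André's letter: "the case of 1-motives without
  abelian part, in which case one recovers Schanuel's conjecture"), which is open ("In general
  Grothendieck's Conjecture is out of reach", Huber–Wüstholz 2022, Prologue p. xiv). Hence there
  is no `ToricPeriodConjecture_holds` / `GPC_holds` to expect: their docstrings begin
  `OPEN CONJECTURE —` and carry `[status: open]` (CONVENTIONS §4). Both NAMES ARE KEPT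
  (`ToricPeriodConjecture` already carries the suffix and is the hypothesis of
  `Summits/Schanuel/Schanuel/Theses/ToricPeriods.lean`, `…/Theorems/ToricPeriodsAssembly.lean` and
  `OneMotiveToricProofs.lean`; `M.GPC` is used in `OneMotiveToricProofs.lean`,
  `Literature/Barriers/Schanuel/PeriodConjectureOverQbarScope.lean` and
  `…/ToricPeriodConjectureQbarProofs.lean`). `GPC` is a *predicate* on `M` (one instance of the
  conjecture per 1-motive; its binder `(M : OneMotiveToric k r n)` is written explicitly on the
  declaration), with proved instances: `gpc_of_eq_zero` (no torus), `gpc_of_schanuel`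
  (conditionally), and in `OneMotiveToricProofs.lean` the torsion case `gpc_of_isOfFinOrder`
  (Lindemann) and the degenerate base case `gpc_of_motGaloisDim_le_trdeg`.
* Named facts (D-0014): `toricPeriodConjecture_iff_schanuel` (Bertolin 2002,
  Cor. 1.3: GPC for all toric 1-motives ⟺ Schanuel's conjecture; the right-hand side is
  *verbatim* `Literature.Periods.SchanuelConjecture` of `Summits/Schanuel/Statement.lean`, which
  Literature cannot import, so the comparison there is `Iff.rfl`), **discharged** below as
  `toricPeriodConjecture_iff_schanuel_holds` following Bertolin's proof (§3.5), and
  `trdeg_periodFieldOver_le_motGaloisDim` (the unconditional upper bound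
  `trdeg_k k(periods(M)) ≤ dim Gal_mot(M)`, toric case of the period-torsor bound; here
  elementary: `k(periods) = k(B)` for a `ℚ`-basis `B ⊆ periodSet` of the span).

## Design choices

* `k` is an `IntermediateField ℚ ℂ` rather than a `Subfield ℂ` (same subfields, since `char ℂ = 0`),
  so that `IntermediateField.adjoin k _`, `restrictScalars ℚ` and `Algebra.trdeg ℚ`/`Algebra.trdeg k`
  are available without ad hoc instances, matching `SchanuelConjecture`'s
  `Algebra.trdeg ℚ ↥(IntermediateField.adjoin ℚ _)`.
* Honest general 1-motives (lattice → semi-abelian variety with Betti/de Rham realisations) are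
  out of reach of Mathlib (no semi-abelian varieties, no algebraic de Rham cohomology); per the
  request, the toric case is a genuine definition and nothing is stubbed. The general GPC is not
  stated here.
* Mathlib has none of: 1-motives, period matrices, Grothendieck/André period conjecture (searched
  `Motive`, `periodConjecture`, `Grothendieck period`); `Complex.exp/log`, `IntermediateField.adjoin`,
  `Algebra.trdeg`, `Submodule.span`, `Module.finrank` are Mathlib's.

## References

* Y. André, *Une introduction aux motifs*, Panoramas et Synthèses 17, SMF 2004, §7.5 and §23.4
  (generalised period conjecture; 1-motives and Schanuel).
* C. Bertolin, *Périodes de 1-motifs et transcendance*, J. Number Theory 97 (2002) 204–221,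
  Conj. 1.1 (elliptico-toric), Cor. 1.3, §3.
* C. Bertolin, *Third kind elliptic integrals and 1-motives* (with a letter of Y. André and an
  appendix by M. Waldschmidt), J. Pure Appl. Algebra 224 (2020) 106396, arXiv:1905.07247:
  Conj. 0.1 (GPC for 1-motives), Rem. 4.3, §3, and André's letter ((?!) and the Remark on the
  unconditional inequality).
* A. Huber, G. Wüstholz, *Transcendence and linear relations of 1-periods*, CUP 2022, Part II.
* P. Deligne, *Théorie de Hodge III*, Publ. Math. IHÉS 44 (1974), §10.1 (1-motives and their
  realisations).
-/

noncomputable section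

open Complex Cardinal

namespace Literature.NumberTheory.Transcendental

/-- A **toric 1-motive** `M = [u : ℤʳ → 𝔾ₘⁿ]` over the subfield `k ⊆ ℂ`: the homomorphism
`u : ℤʳ → 𝔾ₘⁿ(k) = (kˣ)ⁿ` is recorded by the images of the standard basis,
`u(eᵢ) = (u i j)ⱼ` with `u i j ∈ k`, `u i j ≠ 0`. This is Deligne's 1-motive `[X → G]` with
lattice `X = ℤʳ` and semi-abelian part the split torus `G = 𝔾ₘⁿ` (no abelian variety).
[cite: Bertolin2002, §3] -/
structure OneMotiveToric (k : IntermediateField ℚ ℂ) (r n : ℕ) where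
  /-- The matrix of the homomorphism `u : ℤʳ → 𝔾ₘⁿ(k)`: `u i j` is the `j`-th coordinate of
  `u(eᵢ)`. -/
  u : Fin r → Fin n → ℂ
  /-- `u` takes values in `k`-points. -/
  mem : ∀ i j, u i j ∈ k
  /-- `u` takes values in the torus `𝔾ₘⁿ` (non-zero coordinates). -/
  ne_zero : ∀ i j, u i j ≠ 0

namespace OneMotiveToric

variable {k : IntermediateField ℚ ℂ} {r n : ℕ} (M : OneMotiveToric k r n)

/-- All complex logarithms of all entries of `u`: `{ℓ ∈ ℂ | ∃ i j, exp ℓ = u i j}` (every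
determination; they differ by `2πiℤ`). These are the off-diagonal periods of `[ℤʳ → 𝔾ₘⁿ]`.
[cite: Bertolin2002, §3] -/
def logSet : Set ℂ :=
  {ℓ | ∃ i j, cexp ℓ = M.u i j}

/-- The set of (non-trivial) periods of `M = [ℤʳ → 𝔾ₘⁿ]`: `2πi` (the period of `𝔾ₘ`, present iff
`n ≠ 0`) together with all determinations of the `log u i j`; the remaining entries of the
period matrix are `0` and `1`. [cite: Bertolin2002, §3] -/
def periodSet : Set ℂ :=
  {p | n ≠ 0 ∧ p = 2 * Real.pi * I} ∪ M.logSet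

/-- The field `k(periods(M)) ⊆ ℂ` generated over `k` by the periods of `M`, as an intermediate
field between `k` and `ℂ`. [cite: Bertolin2020, Conj. 0.1] -/
def periodFieldOver : IntermediateField k ℂ :=
  IntermediateField.adjoin k M.periodSet

/-- The same field `k(periods(M))` viewed as an intermediate field between `ℚ` and `ℂ`
(restriction of scalars; equal to `ℚ(k ∪ periods(M))`), so that its transcendence degree over
`ℚ` can be taken as in `SchanuelConjecture`. [cite: Bertolin2020, Conj. 0.1] -/
def periodField : IntermediateField ℚ ℂ :=
  M.periodFieldOver.restrictScalars ℚ

/-- The dimension of the motivic Galois group of `M = [u : ℤʳ → 𝔾ₘⁿ]`, computed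
(theorem-as-definition, Bertolin) as `dim_ℚ span_ℚ ({2πi | n ≠ 0} ∪ {log u i j})`
`= [n ≠ 0] · (1 + rk ⟨u i j⟩ ⊗ ℚ)`: the reductive quotient is `𝔾ₘ` iff the torus part is
non-trivial, and the unipotent radical has dimension the multiplicative rank of the `u i j`
modulo torsion. Independent of the determinations of the logarithms. [cite: Bertolin2002, §3] -/
def motGaloisDim : ℕ :=
  Module.finrank ℚ (Submodule.span ℚ M.periodSet)

/-- OPEN CONJECTURE — **André's generalised period conjecture for the toric 1-motive `M`**,
`trdeg_ℚ k(periods(M)) ≥ dim Gal_mot(M)`, POSED (for every pure or mixed motive over any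
subfield `k ⊆ ℂ`) as `(?!)` in Y. André, *Une introduction aux motifs*, Panoramas et Synthèses 17,
SMF 2004, §23.4 ("The first published version of this conjecture (which I made around 1997) is
[IM, 23.4] … it predicts that for any `k ⊂ ℂ`, and any (pure or mixed) motive `M` defined over
`k`, `(?!)` `transc.deg_ℚ k(periods(M)) ≥ dim G_mot(M)`. Of course, since `k` may contain the
periods, one cannot hope for an equality" — André's letter, appendix of Bertolin 2020), and for
1-motives as C. Bertolin, *Third kind elliptic integrals and 1-motives*, J. Pure Appl. Algebra 224
(2020), Introduction [cite: Bertolin2020, Conj. 0.1] [status: open]: "**Conjecture 0.1**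
(Generalized Grothendieck's Period Conjecture for 1-motives). Let `M` be a 1-motive defined over a
sub-field `K` of `ℂ`, then `tran.deg_ℚ K(periods(M)) ≥ dim Gal_mot(M)` where `K(periods(M))` is
the field generated over `K` by the periods of `M`." (earlier, with `K` algebraically closed and
the Mumford–Tate group: Bertolin 2002, p. 205, `(CPG)_K`). This is a **predicate** on the toric
1-motive `M = [u : ℤʳ → 𝔾ₘⁿ]` over `k` — one instance of the conjecture per `M`, the binder
written explicitly — and its universal closure over all `k, r, n, M` is `ToricPeriodConjecture`
below, which is *equivalent to Schanuel's conjecture* (Bertolin 2002, Cor. 1.3;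
`toricPeriodConjecture_iff_schanuel_holds`), an open problem; so there is no `GPC_holds` to
expect (CONVENTIONS §4: a registered OPEN STATEMENT, not named-fact debt), only proved
*instances*: `gpc_of_eq_zero` (`n = 0`), `gpc_of_schanuel` (under Schanuel), and in
`OneMotiveToricProofs.lean` `gpc_of_isOfFinOrder` (all `u i j` roots of unity; Lindemann) and
`gpc_of_motGaloisDim_le_trdeg` (`trdeg_ℚ k ≥ dim` already); the instance `[ℤ → 𝔾ₘ]`, `u(1) = 2`
over `ℚ` is the algebraic independence of `π` and `log 2`, open. Lean rendering (re-verified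
faithful 2026-08-15): `dim Gal_mot(M)` is `M.motGaloisDim = dim_ℚ span_ℚ(periods(M))`
(theorem-as-definition, Bertolin 2002, Prop. 3.4: `dim_ℚ MT(M_ℂ) = 1 + dim_ℚ L(T)`); the
transcendence degree is over `ℚ`, of the field `M.periodField = k(periods(M))` generated over `k`.
Name kept (users in three tree files, listed in the module docstring). -/
def GPC (M : OneMotiveToric k r n) : Prop :=
  (M.motGaloisDim : Cardinal) ≤ Algebra.trdeg ℚ M.periodField

end OneMotiveToric

/-- OPEN CONJECTURE — **the generalised period conjecture for all toric 1-motives**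
`[ℤʳ → 𝔾ₘⁿ]` over all subfields `k ⊆ ℂ` (`∀ k r n M, M.GPC`), i.e. André's `(?!)` (André 2004,
§23.4) restricted to the 1-motives without abelian part, POSED for 1-motives in C. Bertolin,
*Périodes de 1-motifs et transcendance*, J. Number Theory 97 (2002), p. 205 ("Conjecture des
périodes généralisée pour les 1-motifs (André). Si `M` est un 1-motif défini sur `K`, sous-corps de
`ℂ` non nécessairement algébrique, alors `deg.transc_ℚ K(périodes(M)) ≥ dim_ℚ MT(M_ℂ)` `(CPG)_K`")
and singled out there for this class: "**1.3. Corollaire.** Pour les 1-motifs sans partie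
abélienne, `(CPG)_K` est équivalente à la conjecture de Schanuel (CS)" (p. 207, proof §3.5 p. 214)
[cite: Bertolin2002, Cor. 1.3 and §3] [status: open]; likewise Bertolin 2020, Rem. 4.3 ("which in
turn is equivalent to the Schanuel conjecture") and André's letter (ibid., appendix: "The first
test that I made before stating it was the case of 1-motives without abelian part, in which case
one recovers Schanuel's conjecture"). The equivalence with Schanuel's conjecture — verbatim
`Literature.Periods.SchanuelConjecture` of `Summits/Schanuel/Schanuel/Statement.lean` (the summit
`Schanuel`) — is PROVED in tree (`toricPeriodConjecture_iff_schanuel_holds` below), so a proof of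
this statement is a proof of
Schanuel's conjecture, which is open ("In general Grothendieck's Conjecture is out of reach",
Huber–Wüstholz 2022, Prologue p. xiv): there is no `ToricPeriodConjecture_holds` to expect — a
registered OPEN STATEMENT (CONVENTIONS §4: open conjectures are `def …Conjecture : Prop`, never
asserted), not named-fact debt; use it only as an explicit hypothesis
`(h : ToricPeriodConjecture)` (as `schanuel_of_toricPeriodConjecture` and the `ToricPeriods` route
do). Known cases are the proved instances of `OneMotiveToric.GPC` (its docstring). Bertolin takes
`K` algebraically closed; quantifying over all subfields is André's `(?!)`/Bertolin 2020 Conj. 0.1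
form and changes nothing up to the proved equivalence. Name kept (already suffixed; users in
`Summits/Schanuel/Schanuel/Theses/ToricPeriods.lean`, `…/Theorems/ToricPeriodsAssembly.lean`,
`OneMotiveToricProofs.lean`). -/
@[conjecture] def ToricPeriodConjecture : Prop :=
  ∀ (k : IntermediateField ℚ ℂ) (r n : ℕ) (M : OneMotiveToric k r n), M.GPC

/-! ### Basic API -/

namespace OneMotiveToric

variable {k : IntermediateField ℚ ℂ} {r n : ℕ} (M : OneMotiveToric k r n)

/-- Membership in `logSet` unfolds definitionally. [cite: Bertolin2002, §3] -/
theorem mem_logSet_iff {ℓ : ℂ} : ℓ ∈ M.logSet ↔ ∃ i j, cexp ℓ = M.u i j := Iff.rfl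

/-- The principal logarithm of each `u i j` is a period. [cite: Bertolin2002, §3] -/
theorem log_mem_logSet (i : Fin r) (j : Fin n) : Complex.log (M.u i j) ∈ M.logSet :=
  ⟨i, j, Complex.exp_log (M.ne_zero i j)⟩

/-- `logSet ⊆ periodSet`. [cite: Bertolin2002, §3] -/
theorem logSet_subset_periodSet : M.logSet ⊆ M.periodSet :=
  Set.subset_union_right

/-- If the torus part is non-trivial (`n ≠ 0`), `2πi` is a period. [cite: Bertolin2002, §3] -/
theorem two_pi_I_mem_periodSet (hn : n ≠ 0) : (2 * Real.pi * I : ℂ) ∈ M.periodSet :=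
  Or.inl ⟨hn, rfl⟩

/-- `logSet` is stable under adding integer multiples of `2πi` (all determinations are
periods). [cite: Bertolin2002, §3] -/
theorem add_int_mul_mem_logSet {ℓ : ℂ} (hℓ : ℓ ∈ M.logSet) (m : ℤ) :
    ℓ + m * (2 * Real.pi * I) ∈ M.logSet := by
  obtain ⟨i, j, h⟩ := hℓ
  exact ⟨i, j, by rw [Complex.exp_add, Complex.exp_int_mul_two_pi_mul_I, mul_one, h]⟩

/-- With no torus (`n = 0`, `M = ℤʳ` an Artin motive) there are no non-trivial periods.
[cite: Bertolin2002, §3] -/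
theorem periodSet_eq_empty (hn : n = 0) : M.periodSet = ∅ := by
  subst hn
  ext p
  simp only [periodSet, logSet, ne_eq, not_true_eq_false, false_and, Set.setOf_false,
    Set.empty_union, Set.mem_setOf_eq, Set.mem_empty_iff_false, iff_false, not_exists]
  exact fun _ j => j.elim0

/-- With no torus the motivic Galois group is trivial: `motGaloisDim = 0`. [cite: Bertolin2002, §3] -/
theorem motGaloisDim_eq_zero (hn : n = 0) : M.motGaloisDim = 0 := by
  rw [motGaloisDim, M.periodSet_eq_empty hn, Submodule.span_empty, _root_.finrank_bot]

/-- With no torus the conjecture holds trivially (`0 ≤ trdeg`). [cite: Bertolin2002, §3] -/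
theorem gpc_of_eq_zero (hn : n = 0) : M.GPC := by
  rw [GPC, M.motGaloisDim_eq_zero hn, Nat.cast_zero]
  exact zero_le

/-- `periodField` and `periodFieldOver` are the same subset of `ℂ`. [cite: Bertolin2020, Conj. 0.1] -/
@[simp] theorem mem_periodField_iff {z : ℂ} : z ∈ M.periodField ↔ z ∈ M.periodFieldOver :=
  Iff.rfl

/-- `k ⊆ k(periods(M))`. [cite: Bertolin2020, Conj. 0.1] -/
theorem le_periodField : k ≤ M.periodField := fun z hz =>
  (M.mem_periodField_iff).2 (M.periodFieldOver.algebraMap_mem ⟨z, hz⟩)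

/-- Every period lies in the period field. [cite: Bertolin2020, Conj. 0.1] -/
theorem periodSet_subset_periodField : M.periodSet ⊆ M.periodField := fun _ hz =>
  (M.mem_periodField_iff).2 (IntermediateField.subset_adjoin k M.periodSet hz)

/-- Every period is a `ℚ`-combination (indeed `ℤ`-combination) of `2πi` and the principal
logarithms `log u i j`: all determinations of `log u i j` differ from the principal one by
`2πiℤ` (`Complex.exp_eq_exp_iff_exists_int`). Hence the span of the (infinite) period set is the
span of finitely many periods. [cite: Bertolin2002, §3] -/
theorem span_periodSet_le :
    Submodule.span ℚ M.periodSet ≤ Submodule.span ℚ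
      (insert (2 * Real.pi * I) (Set.range fun p : Fin r × Fin n => Complex.log (M.u p.1 p.2))) := by
  refine Submodule.span_le.2 ?_
  rintro p (⟨-, rfl⟩ | ⟨i, j, hp⟩)
  · exact Submodule.subset_span (Set.mem_insert _ _)
  · rw [← Complex.exp_log (M.ne_zero i j)] at hp
    obtain ⟨m, rfl⟩ := Complex.exp_eq_exp_iff_exists_int.1 hp
    refine add_mem (Submodule.subset_span (Set.mem_insert_of_mem _ ⟨(i, j), rfl⟩)) ?_
    rw [← zsmul_eq_mul]
    exact zsmul_mem (Submodule.subset_span (Set.mem_insert _ _)) m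

/-- The `ℚ`-span of the periods is finite-dimensional (of dimension `≤ 1 + r n`), so
`motGaloisDim` is a genuine dimension, not the junk value of `finrank`. [cite: Bertolin2002, §3] -/
instance finiteDimensional_span_periodSet :
    FiniteDimensional ℚ (Submodule.span ℚ M.periodSet) :=
  haveI : FiniteDimensional ℚ (Submodule.span ℚ (insert (2 * Real.pi * I)
      (Set.range fun p : Fin r × Fin n => Complex.log (M.u p.1 p.2)))) :=
    FiniteDimensional.span_of_finite ℚ ((Set.finite_range _).insert _)
  Submodule.finiteDimensional_of_le M.span_periodSet_le

end OneMotiveToric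

/-! ### Named facts (statements; D-0014) -/

/-- **Bertolin 2002, Cor. 1.3 / §3** (André 2004, §23.4): the generalised period conjecture for
all toric 1-motives `[ℤʳ → 𝔾ₘⁿ]` over all subfields of `ℂ` is *equivalent* to Schanuel's
conjecture. The right-hand side is verbatim `Literature.Periods.SchanuelConjecture`
(`Summits/Schanuel/Statement.lean`; Lang 1966, p. 30). Both directions are elementary given the
period computation: (⇐) apply Schanuel to a `ℚ`-basis `B ⊆ periodSet M` of the span, whose
exponentials lie in `{1} ∪ {u i j} ⊆ k`; (⇒) apply GPC to `M = [ℤ → 𝔾ₘⁿ]`, `u(1) = (e^{z_j})`,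
over `k = ℚ(e^{z₁}, …, e^{zₙ})`, and remove `2πi`. [cite: Bertolin2002, Cor. 1.3 and §3] -/
def toricPeriodConjecture_iff_schanuel : Prop :=
  ToricPeriodConjecture ↔
    ∀ (n : ℕ) (z : Fin n → ℂ), LinearIndependent ℚ z →
      (n : Cardinal) ≤ Algebra.trdeg ℚ
        ↥(IntermediateField.adjoin ℚ (Set.range z ∪ Set.range (cexp ∘ z)))

/-- **Unconditional upper bound** (toric case of the period-torsor inequality
`trdeg_k k(periods(M)) ≤ dim Gal_mot(M)`, Deligne/André; André's letter in Bertolin 2020,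
Remark: "inequality `≤` is unconditional"). For `M = [ℤʳ → 𝔾ₘⁿ]` it is elementary:
`k(periods(M)) = k(B)` for any `ℚ`-basis `B ⊆ periodSet M` of `span_ℚ periodSet M` (every period
is a `ℚ`-combination of `B`), so the transcendence degree over `k` is at most `#B = motGaloisDim M`.
[cite: Bertolin2020, letter of André (unconditional inequality)] -/
def trdeg_periodFieldOver_le_motGaloisDim : Prop :=
  ∀ (k : IntermediateField ℚ ℂ) (r n : ℕ) (M : OneMotiveToric k r n),
    Algebra.trdeg k M.periodFieldOver ≤ (M.motGaloisDim : Cardinal)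

/-! ### Discharge of `toricPeriodConjecture_iff_schanuel` (Bertolin 2002, Cor. 1.3, proof §3.5)

The printed proof (Bertolin 2002, §3.5) is followed verbatim. (B) Schanuel ⇒ GPC: apply Schanuel
to a `ℚ`-basis of the span of the periods. (A) GPC ⇒ Schanuel for `x₁, …, xₛ`: apply GPC to
`M = [ℤ → 𝔾ₘˢ]`, `u(1) = (e^{x_j})`, over `ℚ(e^{x_j})` (Bertolin takes the algebraic closure; the
vendored `ToricPeriodConjecture` quantifies over all subfields, so no closure is needed); (A1) if
`2πi ∈ ⟨x_j⟩_ℚ` the dimension is `s` and the period field is `ℚ(x, eˣ)`; (A2) otherwise the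
dimension is `s + 1` and "`trdeg ℚ(x, eˣ, 2πi) ≥ s + 1` implique `trdeg ℚ(x, eˣ) ≥ s`", which we
prove as `trdeg_adjoin_insert_le` from the existence of a transcendence basis inside a generating
set (`exists_isTranscendenceBasis_subset`). -/

-- The `ℚ`-algebra diamond on subfields of `ℂ` (`DivisionRing.toRatAlgebra` vs
-- `IntermediateField.algebra`): elaborate the auxiliary statements below with the latter only,
-- so that `IntermediateField.lift`/`restrictScalars` lemmas rewrite; the two instances are defeq
-- at default transparency, so the final anonymous constructor against the vendored statement
-- typechecks.
attribute [-instance] DivisionRing.toRatAlgebra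

/-- Monotonicity of `trdeg_ℚ` along inclusions of subfields of `ℂ`. [folklore] -/
theorem OneMotiveToric.trdeg_mono {E₁ E₂ : IntermediateField ℚ ℂ} (h : E₁ ≤ E₂) :
    Algebra.trdeg ℚ E₁ ≤ Algebra.trdeg ℚ E₂ :=
  trdeg_le_of_injective (IntermediateField.inclusion h) (IntermediateField.inclusion_injective h)

/-- `ℚ(T)` is algebraic over its `ℚ`-subalgebra generated by (the preimage of) `T` (it is its
fraction field). [folklore] -/
theorem isAlgebraic_adjoin_preimage (T : Set ℂ) :
    Algebra.IsAlgebraic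
      (Algebra.adjoin ℚ (((↑) : IntermediateField.adjoin ℚ T → ℂ) ⁻¹' T))
      (IntermediateField.adjoin ℚ T) := by
  set E := IntermediateField.adjoin ℚ T
  rw [← IntermediateField.isAlgebraic_adjoin_iff_top]
  have h : IntermediateField.adjoin ℚ (((↑) : E → ℂ) ⁻¹' T) = ⊤ := by
    apply IntermediateField.lift_injective E
    rw [IntermediateField.lift_adjoin, IntermediateField.lift_top,
      Set.image_preimage_eq_of_subset]
    intro x hx
    exact ⟨⟨x, IntermediateField.subset_adjoin ℚ T hx⟩, rfl⟩
  rw [h]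
  have : Algebra.IsIntegral (⊤ : IntermediateField ℚ E) E :=
    Algebra.isIntegral_of_surjective fun x => ⟨⟨x, trivial⟩, rfl⟩
  infer_instance

/-- Adjoining one more element raises `trdeg_ℚ` by at most one: a transcendence basis `B` of
`ℚ(T ∪ {a})/ℚ` may be chosen inside `T ∪ {a}`, and `B ∖ {a} ⊆ ℚ(T)` is algebraically independent.
This is the step "`trdeg ℚ(x, eˣ, 2πi) ≥ s + 1` implies `trdeg ℚ(x, eˣ) ≥ s`" of Bertolin's (A2).
[cite: Bertolin2002, §3.5 (A2)] -/
theorem trdeg_adjoin_insert_le (T : Set ℂ) (a : ℂ) :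
    Algebra.trdeg ℚ (IntermediateField.adjoin ℚ (insert a T)) ≤
      Algebra.trdeg ℚ (IntermediateField.adjoin ℚ T) + 1 := by
  set E := IntermediateField.adjoin ℚ (insert a T)
  set F := IntermediateField.adjoin ℚ T
  haveI := isAlgebraic_adjoin_preimage (insert a T)
  obtain ⟨B, hBs, hB⟩ :=
    exists_isTranscendenceBasis_subset (R := ℚ) (A := E) (((↑) : E → ℂ) ⁻¹' insert a T)
  have ha : a ∈ E := IntermediateField.subset_adjoin ℚ _ (Set.mem_insert a T)
  set a' : E := ⟨a, ha⟩
  have hB' : AlgebraicIndependent ℚ ((↑) : ↥(B \ {a'}) → E) := hB.1.mono Set.sdiff_subset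
  have hB'F : ∀ x ∈ B \ {a'}, (x : ℂ) ∈ F := by
    rintro x ⟨hxB, hxa⟩
    rcases hBs hxB with h | h
    · exact absurd (Subtype.ext h) hxa
    · exact IntermediateField.subset_adjoin ℚ T h
  let y : ↥(B \ {a'}) → F := fun x => ⟨x.1.1, hB'F x.1 x.2⟩
  have hy : AlgebraicIndependent ℚ y :=
    AlgebraicIndependent.of_comp F.val (hB'.map' (f := E.val) (RingHom.injective _))
  calc Algebra.trdeg ℚ E = #B := hB.cardinalMk_eq_trdeg.symm
    _ ≤ #(insert a' (B \ {a'}) : Set E) :=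
        Cardinal.mk_le_mk_of_subset (Set.subset_insert_sdiff_singleton a' B)
    _ ≤ #(↥(B \ {a'})) + 1 := Cardinal.mk_insert_le
    _ ≤ Algebra.trdeg ℚ F + 1 := by
        gcongr
        exact hy.cardinalMk_le_trdeg

namespace OneMotiveToric

variable {k : IntermediateField ℚ ℂ} {r n : ℕ} (M : OneMotiveToric k r n)

/-- The exponential of a period lies in the period field: it is `1` (for `2πi`) or some
`u i j ∈ k` (for a logarithm). [cite: Bertolin2002, §3.5 (B)] -/
theorem exp_mem_periodField {p : ℂ} (hp : p ∈ M.periodSet) : cexp p ∈ M.periodField := by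
  rcases hp with ⟨-, rfl⟩ | ⟨i, j, h⟩
  · rw [Complex.exp_two_pi_mul_I]; exact one_mem _
  · rw [h]; exact M.le_periodField (M.mem i j)

/-- **Bertolin 2002, §3.5 (B)**: Schanuel's conjecture implies the generalised period conjecture
for every toric 1-motive `M`: apply Schanuel to a `ℚ`-basis `b ⊆ periodSet M` of the `ℚ`-span
of the periods (`#b = motGaloisDim M`); the field `ℚ(b, exp b)` lies in `k(periods(M))` since
`exp b ⊆ {1} ∪ {u i j} ⊆ k`. [cite: Bertolin2002, §3.5 (B)] -/
theorem gpc_of_schanuel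
    (hS : ∀ (n : ℕ) (z : Fin n → ℂ), LinearIndependent ℚ z →
      (n : Cardinal) ≤ Algebra.trdeg ℚ
        ↥(IntermediateField.adjoin ℚ (Set.range z ∪ Set.range (cexp ∘ z)))) :
    M.GPC := by
  obtain ⟨b, hb, hspan, hli⟩ := exists_linearIndependent ℚ M.periodSet
  have hrank : (M.motGaloisDim : Cardinal) = #b := by
    rw [motGaloisDim, Module.finrank_eq_rank, ← hspan, rank_span_set hli]
  haveI : Finite b := Cardinal.lt_aleph0_iff_finite.mp (hrank ▸ Cardinal.natCast_lt_aleph0)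
  set e := Finite.equivFin b
  set z : Fin (Nat.card b) → ℂ := fun i => (e.symm i : ℂ)
  have hz : LinearIndependent ℚ z := hli.comp _ e.symm.injective
  have h := hS _ z hz
  rw [GPC, hrank, Cardinal.mk_congr e, Cardinal.mk_fin]
  refine h.trans (trdeg_mono (IntermediateField.adjoin_le_iff.mpr ?_))
  rintro _ (⟨i, rfl⟩ | ⟨i, rfl⟩)
  · exact M.periodSet_subset_periodField (hb (e.symm i).2)
  · exact M.exp_mem_periodField (hb (e.symm i).2)

end OneMotiveToric

/-- **Bertolin 2002, §3.5 (A)**: the generalised period conjecture for the toric 1-motives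
`M = [ℤ → 𝔾ₘⁿ]`, `u(1) = (e^{z₁}, …, e^{zₙ})`, over `k = ℚ(e^{z₁}, …, e^{zₙ})` implies Schanuel's
conjecture for `z`. The periods of `M` span `⟨2πi, z₁, …, zₙ⟩_ℚ` and generate, over `k`, a
subfield of `ℚ(2πi, z, e^z)`. (A1) If `2πi ∈ ⟨z⟩_ℚ` then `dim = n` and the field is `ℚ(z, e^z)`.
(A2) Otherwise `dim = n + 1` and `trdeg ℚ(2πi, z, e^z) ≤ trdeg ℚ(z, e^z) + 1`.
[cite: Bertolin2002, §3.5 (A)] -/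
theorem schanuel_of_toricPeriodConjecture (h : ToricPeriodConjecture) (n : ℕ) (z : Fin n → ℂ)
    (hz : LinearIndependent ℚ z) :
    (n : Cardinal) ≤ Algebra.trdeg ℚ
      ↥(IntermediateField.adjoin ℚ (Set.range z ∪ Set.range (cexp ∘ z))) := by
  rcases Nat.eq_zero_or_pos n with rfl | hn
  · simp
  set T := Set.range z ∪ Set.range (cexp ∘ z)
  set k : IntermediateField ℚ ℂ := IntermediateField.adjoin ℚ (Set.range (cexp ∘ z))
  let M : OneMotiveToric k 1 n :=
    ⟨fun _ j => cexp (z j), fun _ j => IntermediateField.subset_adjoin ℚ _ ⟨j, rfl⟩,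
      fun _ j => Complex.exp_ne_zero _⟩
  have hM : (M.motGaloisDim : Cardinal) ≤ Algebra.trdeg ℚ M.periodField := h k 1 n M
  -- the period field `k(periods(M))` is contained in `E = ℚ(2πi, z, exp z)`
  set E := IntermediateField.adjoin ℚ (insert (2 * Real.pi * I) T)
  have hTE : T ⊆ E := (Set.subset_insert _ T).trans (IntermediateField.subset_adjoin ℚ _)
  have h2E : (2 * Real.pi * I : ℂ) ∈ E := IntermediateField.subset_adjoin ℚ _ (Set.mem_insert _ _)
  have hE : M.periodField ≤ E := by
    change (IntermediateField.adjoin k M.periodSet).restrictScalars ℚ ≤ E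
    rw [IntermediateField.restrictScalars_adjoin, IntermediateField.adjoin_le_iff]
    rintro p (hp | ⟨-, rfl⟩ | ⟨i, j, hp⟩)
    · exact IntermediateField.adjoin.mono ℚ _ _
        (Set.subset_union_right.trans (Set.subset_insert _ T)) hp
    · exact h2E
    · obtain ⟨m, rfl⟩ := Complex.exp_eq_exp_iff_exists_int.1 hp
      exact add_mem (hTE (Or.inl ⟨j, rfl⟩)) (mul_mem (E.intCast_mem m) h2E)
  -- the periods contain `2πi` and the `z j`
  have hspan : Submodule.span ℚ (insert (2 * Real.pi * I) (Set.range z)) ≤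
      Submodule.span ℚ M.periodSet := by
    refine Submodule.span_mono ?_
    rintro p (rfl | ⟨j, rfl⟩)
    · exact M.two_pi_I_mem_periodSet hn.ne'
    · exact M.logSet_subset_periodSet ⟨0, j, rfl⟩
  have hdim : Module.rank ℚ (Submodule.span ℚ (insert (2 * Real.pi * I) (Set.range z))) ≤
      (M.motGaloisDim : Cardinal) := by
    rw [OneMotiveToric.motGaloisDim, Module.finrank_eq_rank]
    exact Submodule.rank_mono hspan
  have hzr : #(Set.range z) = n := by rw [Cardinal.mk_range_eq z hz.injective, Cardinal.mk_fin]
  have key := (hdim.trans hM).trans (OneMotiveToric.trdeg_mono hE)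
  by_cases h2 : (2 * Real.pi * I : ℂ) ∈ Submodule.span ℚ (Set.range z)
  · -- (A1): `E ≤ ℚ(z, exp z)` and `dim ≥ n`
    have hEF : E ≤ IntermediateField.adjoin ℚ T := by
      rw [IntermediateField.adjoin_le_iff, Set.insert_subset_iff]
      refine ⟨?_, IntermediateField.subset_adjoin ℚ T⟩
      have hle : Submodule.span ℚ (Set.range z) ≤
          (IntermediateField.adjoin ℚ T).toSubalgebra.toSubmodule :=
        Submodule.span_le.mpr fun x hx => IntermediateField.subset_adjoin ℚ T (Or.inl hx)
      exact hle h2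
    rw [Submodule.span_insert_eq_span h2, rank_span_set hz.linearIndepOn_id, hzr] at key
    exact key.trans (OneMotiveToric.trdeg_mono hEF)
  · -- (A2): `dim ≥ n + 1` and `trdeg E ≤ trdeg ℚ(z, exp z) + 1`
    have h2' : (2 * Real.pi * I : ℂ) ∉ Set.range z := fun h' => h2 (Submodule.subset_span h')
    rw [rank_span_set (hz.linearIndepOn_id.id_insert h2), Cardinal.mk_insert h2', hzr] at key
    exact Cardinal.add_one_le_add_one_iff.mp (key.trans (trdeg_adjoin_insert_le T _))

/-- **Bertolin 2002, Cor. 1.3** holds: the generalised period conjecture for all toric 1-motives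
is equivalent to Schanuel's conjecture (`schanuel_of_toricPeriodConjecture`,
`OneMotiveToric.gpc_of_schanuel`). [cite: Bertolin2002, Cor. 1.3, proof §3.5] -/
theorem toricPeriodConjecture_iff_schanuel_holds : toricPeriodConjecture_iff_schanuel :=
  ⟨fun h n z hz => schanuel_of_toricPeriodConjecture h n z hz,
    fun hS _k _r _n M => M.gpc_of_schanuel hS⟩

end Literature.NumberTheory.Transcendental

end
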